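import Mathlib
import Literature.Barriers.ValiantsHypothesis.AlgebraicNaturalProofs
import Literature.Computability.AlgebraicComplexity.RazUniversalCircuits
import Literature.Computability.AlgebraicComplexity.ValiantClasses
import Literature.Computability.AlgebraicComplexity.ArithCircuitProofs
import Literature.Computability.AlgebraicComplexity.HamiltonianCycleVNP
import Summits.ValiantsHypothesis.ValiantsHypothesis.Theorems.BarrierLeverDefinableEquationsDefs

/-!
# Crux `BarrierLever.DefinableEquations` (stmt-ValiantsHypothesis-8745), line `registered` —
# stub `stub_weightGadget` (V2): the weight gadget

For a block `k` of `n` tensor positions the symmetric-tensor weight `∏_l e_l!` of the exponent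
vector `e = expOf (i (k, ·))` is the value, at the one-hot point of the index function `i`, of the
polynomial in the Boolean block

  `G_k = ∏_{pos} (1 + ∑_{pos' < pos} ∑_l Z_{(k,pos),l} · Z_{(k,pos'),l})`.

Indeed at the one-hot point `Z_{(k,pos),l} = [i (k,pos) = l]`, so the `pos`-factor is
`1 + #{pos' < pos | i (k,pos') = i (k,pos)}`; regrouping the product over `pos` by the value
`l = i (k,pos)`, the fibre of `l` (of size `e_l`) contributes the factors `1, 2, …, e_l`, i.e.
`e_l!` (`prod_one_add_card_filter_lt`, `prod_one_add_card_eq_prod_factorial`).  No interpolation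
of the factorial is needed.  Size `≤ (B+n+2)^4`, degree `≤ 2n ≤ (B+n+2)^2`.

References: P. Bürgisser, *Completeness and Reduction in Algebraic Complexity Theory* (2000),
Prop. 2.20 (Valiant's criterion: the shape of such witnesses); J. M. Landsberg, *Geometry and
Complexity Theory* (2017), §8.6 (the weights `∏_l e_l!` of symmetric tensors vs. polynomials).
-/

noncomputable section

-- single-conjunct layout: Sub = Summit, duplicated namespace component intended
set_option linter.dupNamespace false

namespace Summit.ValiantsHypothesis.ValiantsHypothesis.Theorems.BarrierLeverDefinableEquations

open MvPolynomial Literature.Computability.AlgebraicComplexity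
open Literature.Barriers.ValiantsHypothesis

namespace WeightGadget

/-! ### The combinatorial identity `∏_{pos} (1 + #{pos' < pos | v pos' = v pos}) = ∏_l e_l!` -/

/-- In a finite subset `s` of a linear order, `∏_{x ∈ s} (1 + #{y ∈ s | y < x}) = (#s)!`: the
factors are `1, 2, …, #s` (induction on the maximum). [folklore] -/
theorem prod_one_add_card_filter_lt {α : Type*} [LinearOrder α] (s : Finset α) :
    ∏ x ∈ s, (1 + (s.filter (· < x)).card) = s.card.factorial := by
  classical
  induction s using Finset.induction_on_max with
  | empty => simp
  | insert a s ha ih =>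
    have han : a ∉ s := fun h => lt_irrefl a (ha a h)
    have h1 : (insert a s).filter (· < a) = s := by
      rw [Finset.filter_insert, if_neg (lt_irrefl a), Finset.filter_true_of_mem ha]
    have h2 : ∀ x ∈ s, (insert a s).filter (· < x) = s.filter (· < x) := fun x hx => by
      rw [Finset.filter_insert, if_neg (not_lt.2 (ha x hx).le)]
    rw [Finset.prod_insert han, h1, Finset.prod_congr rfl fun x hx => by rw [h2 x hx], ih,
      Finset.card_insert_of_notMem han, Nat.factorial_succ, Nat.add_comm 1]

/-- `∏_{pos} (1 + #{pos' < pos | v pos' = v pos}) = ∏_l (#{pos | v pos = l})!`: regroup the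
product by the value `l = v pos`; inside the fibre of `l` the factors are `1, …, #fibre`.
[folklore] -/
theorem prod_one_add_card_eq_prod_factorial {n : ℕ} (v : Fin n → Fin n) :
    ∏ pos, (1 + ((Finset.univ.filter (· < pos)).filter fun pos' => v pos' = v pos).card) =
      ∏ l, (Finset.univ.filter fun pos => v pos = l).card.factorial := by
  refine (Finset.prod_fiberwise Finset.univ v _).symm.trans (Finset.prod_congr rfl fun l _ => ?_)
  rw [← prod_one_add_card_filter_lt]
  refine Finset.prod_congr rfl fun pos hpos => ?_
  rw [Finset.mem_filter] at hpos
  rw [hpos.2, Finset.filter_filter, Finset.filter_filter]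
  congr 2
  exact Finset.filter_congr fun pos' _ => and_comm

/-- The exponent vector of a block counts the positions carrying each index:
`(expOf v) l = #{pos | v pos = l}`. [folklore] -/
theorem expOf_apply {n : ℕ} (v : Fin n → Fin n) (l : Fin n) :
    expOf v l = (Finset.univ.filter fun pos => v pos = l).card := by
  simp [expOf, Finsupp.single_apply]

/-- The weight gadget at a `0/1` point: with `Z_{pos,l} := [v pos = l]`,
`∏_{pos} (1 + ∑_{pos' < pos} ∑_l Z_{pos,l} Z_{pos',l}) = symWeight (expOf v) = ∏_l e_l!`.
[folklore] -/
theorem prod_boole_eq_symWeight {R : Type*} [CommSemiring R] {n : ℕ} (v : Fin n → Fin n) :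
    (∏ pos : Fin n, (1 + ∑ pos' ∈ Finset.univ.filter (· < pos), ∑ l : Fin n,
        (if v pos = l then (1 : R) else 0) * (if v pos' = l then (1 : R) else 0))) =
      (symWeight (expOf v) : R) := by
  have h1 : ∀ pos pos' : Fin n, (∑ l : Fin n,
      (if v pos = l then (1 : R) else 0) * (if v pos' = l then (1 : R) else 0)) =
        if v pos' = v pos then 1 else 0 := by
    intro pos pos'
    simp only [ite_mul, one_mul, zero_mul, Finset.sum_ite_eq, Finset.mem_univ, if_true]
  simp_rw [h1, Finset.sum_boole]
  have h2 := congrArg (Nat.cast (R := R)) (prod_one_add_card_eq_prod_factorial v)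
  push_cast at h2
  rw [h2, symWeight, Nat.cast_prod]
  exact Finset.prod_congr rfl fun l _ => by rw [expOf_apply]

/-! ### Size and degree of the gadget -/

section Bounds

variable {σ : Type*} {n : ℕ} (x : Fin n → Fin n → σ)

/-- The `pos`-factor `1 + ∑_{pos' < pos} ∑_l X_{pos,l} X_{pos',l}` has complexity
`≤ 2n² + n + 1` (inputs are free, one gate per product / sum). [folklore] -/
theorem complexity_weightFactor_le (pos : Fin n) :
    complexity (1 + ∑ pos' ∈ Finset.univ.filter (· < pos), ∑ l : Fin n,
        X (x pos l) * X (x pos' l) : MvPolynomial σ ℂ) ≤ n * (n * 1 + n) + n + 1 := by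
  have hS : complexity (∑ pos' ∈ Finset.univ.filter (· < pos), ∑ l : Fin n,
      X (x pos l) * X (x pos' l) : MvPolynomial σ ℂ) ≤ n * (n * 1 + n) + n := by
    refine (complexity_sum_le_of_le _ _ (n * 1 + n) fun pos' _ => ?_).trans ?_
    · refine (complexity_sum_le_of_le _ _ 1 fun l _ => ?_).trans (by simp)
      have h1 := complexity_mul_le_holds (X (x pos l) : MvPolynomial σ ℂ) (X (x pos' l))
      have h2 := complexity_X_holds (k := ℂ) (σ := σ) (x pos l)
      have h3 := complexity_X_holds (k := ℂ) (σ := σ) (x pos' l)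
      omega
    · have hc : (Finset.univ.filter (· < pos)).card ≤ n :=
        (Finset.card_filter_le _ _).trans (by simp)
      exact Nat.add_le_add (Nat.mul_le_mul_right _ hc) hc
  have h0 := complexity_C_holds (σ := σ) (1 : ℂ)
  rw [C_1] at h0
  have h := complexity_add_le_holds (1 : MvPolynomial σ ℂ)
    (∑ pos' ∈ Finset.univ.filter (· < pos), ∑ l : Fin n, X (x pos l) * X (x pos' l))
  omega

/-- The gadget `∏_{pos} (1 + ∑_{pos' < pos} ∑_l X_{pos,l} X_{pos',l})` has complexity
`≤ n (2n² + n + 1) + n`. [folklore] -/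
theorem complexity_weightGadget_le :
    complexity (∏ pos : Fin n, (1 + ∑ pos' ∈ Finset.univ.filter (· < pos), ∑ l : Fin n,
        X (x pos l) * X (x pos' l)) : MvPolynomial σ ℂ) ≤ n * (n * (n * 1 + n) + n + 1) + n :=
  (complexity_prod_le_of_le _ _ _ fun pos _ => complexity_weightFactor_le x pos).trans (by simp)

/-- The gadget has degree `≤ 2n` (each factor has degree `≤ 2`). [folklore] -/
theorem totalDegree_weightGadget_le :
    (∏ pos : Fin n, (1 + ∑ pos' ∈ Finset.univ.filter (· < pos), ∑ l : Fin n,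
        X (x pos l) * X (x pos' l)) : MvPolynomial σ ℂ).totalDegree ≤ n * 2 := by
  refine (totalDegree_prod_le_of_le _ _ 2 fun pos _ => ?_).trans (by simp)
  refine (totalDegree_add _ _).trans (max_le (by simp) ?_)
  refine totalDegree_sum_le_of_le _ _ 2 fun pos' _ =>
    totalDegree_sum_le_of_le _ _ 2 fun l _ => ?_
  exact (totalDegree_mul _ _).trans
    (add_le_add (totalDegree_X_le_one _) (totalDegree_X_le_one _))

end Bounds

end WeightGadget

/-! ### The stub -/

open WeightGadget in
/-- **V2 — the weight gadget.** For every block `k` the polynomial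
`G_k = ∏_{pos} (1 + ∑_{pos' < pos} ∑_l Z_{(k,pos),l} Z_{(k,pos'),l})` of the one-hot Boolean
block has complexity `≤ (B+n+2)^4`, degree `≤ (B+n+2)^2`, and value `∏_l e_l!`
(`e = expOf (i (k, ·))`) at the one-hot point of every index function `i`. [folklore] -/
theorem stub_weightGadget :
    ∀ (n : ℕ) (τ : TabDatum n) (B : ℕ), τ.Bounded B → weightSpec n τ B := by
  intro n τ B _
  refine ⟨fun k => ∏ pos : Fin n, (1 + ∑ pos' ∈ Finset.univ.filter (· < pos), ∑ l : Fin n,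
    X (Sum.inr ((k, pos), l)) * X (Sum.inr ((k, pos'), l))), fun k => ⟨?_, ?_, fun i => ?_⟩⟩
  · refine (complexity_weightGadget_le fun pos l => (Sum.inr ((k, pos), l) :
      topMonomials n ⊕ BPos τ.D n)).trans ?_
    refine le_trans ?_ (Nat.pow_le_pow_left (show n + 2 ≤ B + n + 2 by omega) 4)
    nlinarith [Nat.zero_le (n ^ 2), Nat.zero_le (n ^ 3), Nat.zero_le (n ^ 4)]
  · refine (totalDegree_weightGadget_le fun pos l => (Sum.inr ((k, pos), l) :
      topMonomials n ⊕ BPos τ.D n)).trans ?_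
    refine le_trans ?_ (Nat.pow_le_pow_left (show n + 2 ≤ B + n + 2 by omega) 2)
    nlinarith [Nat.zero_le (n ^ 2)]
  · simp only [map_prod, map_add, map_one, map_sum, map_mul, aeval_X, boolPt, Sum.elim_inr,
      oneHot, decide_eq_true_eq]
    rw [map_natCast]
    exact prod_boole_eq_symWeight fun l => i (k, l)

end Summit.ValiantsHypothesis.ValiantsHypothesis.Theorems.BarrierLeverDefinableEquations

end
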